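import Summits.CriticalPhenomena.PercolationContinuityZ3.Theorems.Transplant.SitePreFKGTower
import Summits.CriticalPhenomena.PercolationContinuityZ3.Theorems.Transplant.SitePeel
import HarnessLib

/-!
# SITE percolation: Kozma–Nitzan's pre-FKG Conjecture 4 for EVERY relay set — the pre-FKG surplus peeling from the
# site conditioned slack hierarchy (site twin of `Theorems/PercNearOneGluingNoHeavyLowerTailKNConj4PreMargin.lean`, prim-ineq-gen-6;
# lane `prim-bschramm` C1a, prover `prim-hp-8` gen 17 — file 2/3 of the SITE Conjecture 4 / 2 transplant)

builds on p205010 (kernel theorem, internal audit signed; external expert review pending).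

Kozma–Nitzan, CONJECTURE 4 (p. 32), SITE model (convention A: `u ↔ a` = both open and joined by open vertices): for every monotone
cluster property `F`, every relay set `X`, every `u`: `E[F(C_u); u ↔ X] ≥ min_{a∈X} E[F(C_a); u ↔ X]`.  As in the bond file, with
`Δ_u(X) := ∫_{u ↔ X} (F(C_u) − F(C_c))` (`c ∈ X` of least mean) the level-form margin `Marg_{X,D}[u ↦ Δ_u(X)]` is `≥ 0` for every
decoy list (`SitePreFKG.preMargin_nonneg_of_siteCSH`), by hp-8's peeling with `Sur ↦ Δ` and no rank: peel any `k ≠ c`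
(`SitePreFKG.preSurplus_erase_add`); by the site tower property along `σ(C_k)` (`SitePreFKG.setIntegral_sub_eq_projFun`, file 1) the peeled
term is the one-cluster quantity `∫_{D_k ∩ {k↔u}} G_k(C_k)` for the MONOTONE projected functional `G_k(K) = F(K) − E[F(C_c) | C_k = K]`
(`SitePreFKG.monotone_projFun`), to which site CSH applies; `∫_{D_k} G_k = (m_k − m_c) − Δ_k(X∖k) ≥ −Δ_k(X∖k)` replaces Lemma κ;
Lemma AC = site CSH at `Ψ_iso` (`SiteCSH.covD_psiIso`); base `X = {c}` trivial.  The hypothesis `hCSH` has EXACTLY the shape consumed by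
`SiteCSH.s5dMargin_nonneg_of_siteCSH` and is discharged (file 3) by `SiteCSH.siteCSHAll_holds` (p215077).
Support file (`--supports stmt-CriticalPhenomena-4575 --as helper`); no definitions, no named facts, no sorries.
[cite: KozmaNitzan2024, Conj. 4 and Thms. 7–9 (p. 32), Conj. 2 (p. 3), Question 7 (p. 36)] [cite: VandenbergHaggstromKahn2005, Thm. 1.3 (p. 6), §2.1 Lemma 2.4 (p. 10)]
-/

noncomputable section

namespace Summit.CriticalPhenomena.PercolationContinuityZ3.Theorems.Transplant

namespace SitePreFKG

open MeasureTheory Set Literature.Probability.LatticeModels Literature.Probability.Percolation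
open Summit.CriticalPhenomena.PercolationContinuityZ3.Theorems.CSH (slForm cshMarg cshMarg_nil cshMarg_cons cshMarg_add
  cshMarg_smul cshMarg_sub cshMarg_congr slForm_zero)
open Summit.CriticalPhenomena.PercolationContinuityZ3.Theorems.SiteTransplant (siteConn mem_siteConn)
open SiteGen (mem_siteConn_iff_mem_siteCluster siteCluster_eq_of_mem siteConn_comm)
open SiteBHK2 (bar)
open SiteCSH (avoidConst decoyList obsConst covD cshMargin SiteCSHHolds psiIsoSite psiIso_mono covD_psiIso mem_decoyList)
open scoped Classical

variable {n : ℕ} {Γ : SimpleGraph (Fin n)}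

/-- Membership in the site event `{u ↔ X}`. [folklore] -/
theorem mem_iUnion_siteConn (X : Finset (Fin n)) (u : Fin n) (ω : Set (Fin n)) :
    ω ∈ (⋃ a ∈ X, (siteConn Γ u a : Set (Set (Fin n)))) ↔ ∃ a ∈ X, a ∈ siteCluster Γ ω u := by
  simp only [mem_iUnion, exists_prop]
  rfl

/-- **Peeling an arbitrary relay off the site pre-FKG surplus.**  For `k ∈ X` and every `u`:
`Δ_u(X) = Δ_u(X.erase k) + ∫_{{k ↮ X.erase k} ∩ {k ↔ u}} (F(C_k) − F(C_c))` (on the new part `C_u = C_k`).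
[cite: KozmaNitzan2024, Conj. 4 (p. 32)] -/
theorem preSurplus_erase_add (q : Fin n → unitInterval) (X : Finset (Fin n)) (F : Set (Fin n) → ℝ) (c k u : Fin n)
    (hkX : k ∈ X) :
    ∫ ω in ⋃ a ∈ X, siteConn Γ u a, (F (siteCluster Γ ω u) - F (siteCluster Γ ω c)) ∂(prodBernoulli q) =
      (∫ ω in ⋃ a ∈ X.erase k, siteConn Γ u a, (F (siteCluster Γ ω u) - F (siteCluster Γ ω c)) ∂(prodBernoulli q)) +
        ∫ ω in {ω : Set (Fin n) | ∀ a ∈ (↑(X.erase k) : Set (Fin n)), a ∉ siteCluster Γ ω k} ∩ siteConn Γ k u,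
          (F (siteCluster Γ ω k) - F (siteCluster Γ ω c)) ∂(prodBernoulli q) := by
  have hmeas : ∀ S : Set (Set (Fin n)), MeasurableSet S := fun _ => MeasurableSet.of_discrete
  have hint : ∀ (g : Set (Fin n) → ℝ), Integrable g (prodBernoulli q) := fun g => Integrable.of_finite
  set gu : Set (Fin n) → ℝ := fun ω => F (siteCluster Γ ω u) - F (siteCluster Γ ω c) with hgu
  set gk : Set (Fin n) → ℝ := fun ω => F (siteCluster Γ ω k) - F (siteCluster Γ ω c) with hgk
  set Dk : Set (Set (Fin n)) := {ω : Set (Fin n) | ∀ a ∈ (↑(X.erase k) : Set (Fin n)), a ∉ siteCluster Γ ω k} with hDk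
  have hpt : ∀ ω : Set (Fin n), (⋃ a ∈ X, (siteConn Γ u a : Set (Set (Fin n)))).indicator gu ω =
      (⋃ a ∈ X.erase k, (siteConn Γ u a : Set (Set (Fin n)))).indicator gu ω + (Dk ∩ siteConn Γ k u).indicator gk ω := by
    intro ω
    by_cases h1 : ∃ a ∈ X.erase k, a ∈ siteCluster Γ ω u
    · obtain ⟨a, ha, hua⟩ := h1
      have m1 : ω ∈ ⋃ a ∈ X, (siteConn Γ u a : Set (Set (Fin n))) :=
        (mem_iUnion_siteConn X u ω).2 ⟨a, Finset.mem_of_mem_erase ha, hua⟩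
      have m2 : ω ∈ ⋃ a ∈ X.erase k, (siteConn Γ u a : Set (Set (Fin n))) := (mem_iUnion_siteConn _ u ω).2 ⟨a, ha, hua⟩
      have m3 : ω ∉ Dk ∩ siteConn Γ k u := by
        intro h
        have hku : u ∈ siteCluster Γ ω k := (mem_siteConn_iff_mem_siteCluster Γ k u ω).1 h.2
        have heq : siteCluster Γ ω k = siteCluster Γ ω u := siteCluster_eq_of_mem Γ hku
        exact h.1 a (Finset.mem_coe.2 ha) (heq ▸ hua)
      rw [indicator_of_mem m1, indicator_of_mem m2, indicator_of_notMem m3, add_zero]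
    · by_cases h2 : k ∈ siteCluster Γ ω u
      · have m1 : ω ∈ ⋃ a ∈ X, (siteConn Γ u a : Set (Set (Fin n))) := (mem_iUnion_siteConn X u ω).2 ⟨k, hkX, h2⟩
        have m2 : ω ∉ ⋃ a ∈ X.erase k, (siteConn Γ u a : Set (Set (Fin n))) := fun h => h1 ((mem_iUnion_siteConn _ u ω).1 h)
        have heq : siteCluster Γ ω u = siteCluster Γ ω k := siteCluster_eq_of_mem Γ h2
        have m3 : ω ∈ Dk ∩ siteConn Γ k u := by
          refine ⟨fun a ha hka => h1 ⟨a, Finset.mem_coe.1 ha, heq ▸ hka⟩, ?_⟩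
          rw [siteConn_comm]
          exact (mem_siteConn_iff_mem_siteCluster Γ u k ω).2 h2
        rw [indicator_of_mem m1, indicator_of_notMem m2, indicator_of_mem m3, zero_add, hgu, hgk]
        simp only [heq]
      · have m1 : ω ∉ ⋃ a ∈ X, (siteConn Γ u a : Set (Set (Fin n))) := by
          intro h
          obtain ⟨a, ha, hua⟩ := (mem_iUnion_siteConn X u ω).1 h
          by_cases hak : a = k
          · exact h2 (hak ▸ hua)
          · exact h1 ⟨a, Finset.mem_erase.2 ⟨hak, ha⟩, hua⟩
        have m2 : ω ∉ ⋃ a ∈ X.erase k, (siteConn Γ u a : Set (Set (Fin n))) := fun h => h1 ((mem_iUnion_siteConn _ u ω).1 h)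
        have m3 : ω ∉ Dk ∩ siteConn Γ k u := by
          intro h
          have hku : u ∈ siteCluster Γ ω k := (mem_siteConn_iff_mem_siteCluster Γ k u ω).1 h.2
          have : ω ∈ siteConn Γ u k := by rw [siteConn_comm]; exact h.2
          exact h2 ((mem_siteConn_iff_mem_siteCluster Γ u k ω).1 this)
        rw [indicator_of_notMem m1, indicator_of_notMem m2, indicator_of_notMem m3, add_zero]
  rw [← integral_indicator (hmeas _), ← integral_indicator (hmeas _), ← integral_indicator (hmeas _),
    ← integral_add (hint _) (hint _)]
  exact integral_congr_ae (Filter.Eventually.of_forall hpt)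

/-- **(pS5D)_site from site CSH — the site pre-FKG surplus margin is nonnegative.**  Non-degenerate vertex weights, observers `o, v`
with the site conditioned slack hierarchy available for every owner / avoided set / decoy list (hypothesis `hCSH` verbatim as in
`SiteCSH.s5dMargin_nonneg_of_siteCSH`).  Then for every relay set `X`, every `c ∈ X` with `E F(C_c) ≤ E F(C_a)` for all `a ∈ X`, every
decoy list `D` and every monotone `F`:  `0 ≤ Marg_{X,D}[u ↦ ∫_{u↔X} (F(C_u) − F(C_c))]`.
[cite: KozmaNitzan2024, Conj. 4 (p. 32)] [cite: VandenbergHaggstromKahn2005, §2.1 Lemma 2.4 (p. 10)] -/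
theorem preMargin_nonneg_of_siteCSH (q : Fin n → unitInterval) (hq : ∀ v, 0 < q v ∧ q v < 1) (o v : Fin n)
    (hCSH : ∀ (x : Fin n) (Y : Finset (Fin n)) (D : List (Fin n)),
      x ∉ Y → o ≠ x → v ≠ x → o ∉ Y → v ∉ Y → D.Nodup → (∀ d ∈ D, d ≠ x ∧ d ∉ Y ∧ d ≠ o ∧ d ≠ v) →
      SiteCSHHolds Γ q x (↑Y : Set (Fin n)) D o v) :
    ∀ (X : Finset (Fin n)) (c : Fin n) (D : List (Fin n)) (F : Set (Fin n) → ℝ),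
      (∀ S S' : Set (Fin n), S ⊆ S' → F S ≤ F S') → c ∈ X →
      (∀ a ∈ X, ∫ ω, F (siteCluster Γ ω c) ∂(prodBernoulli q) ≤ ∫ ω, F (siteCluster Γ ω a) ∂(prodBernoulli q)) →
      o ∉ X → v ∉ X → D.Nodup → (∀ d ∈ D, d ∉ X ∧ d ≠ o ∧ d ≠ v) →
      0 ≤ cshMarg (decoyList Γ q (↑X : Set (Fin n)) D) (obsConst Γ q o v ((↑X : Set (Fin n)) ∪ {d | d ∈ D})) o v
        (fun u => ∫ ω in ⋃ a ∈ X, siteConn Γ u a, (F (siteCluster Γ ω u) - F (siteCluster Γ ω c)) ∂(prodBernoulli q)) := by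
  have main : ∀ (N : ℕ) (X : Finset (Fin n)) (c : Fin n) (D : List (Fin n)) (F : Set (Fin n) → ℝ), X.card = N →
      (∀ S S' : Set (Fin n), S ⊆ S' → F S ≤ F S') → c ∈ X →
      (∀ a ∈ X, ∫ ω, F (siteCluster Γ ω c) ∂(prodBernoulli q) ≤ ∫ ω, F (siteCluster Γ ω a) ∂(prodBernoulli q)) →
      o ∉ X → v ∉ X → D.Nodup → (∀ d ∈ D, d ∉ X ∧ d ≠ o ∧ d ≠ v) →
      0 ≤ cshMarg (decoyList Γ q (↑X : Set (Fin n)) D) (obsConst Γ q o v ((↑X : Set (Fin n)) ∪ {d | d ∈ D})) o v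
        (fun u => ∫ ω in ⋃ a ∈ X, siteConn Γ u a, (F (siteCluster Γ ω u) - F (siteCluster Γ ω c)) ∂(prodBernoulli q)) := by
    intro N
    induction N using Nat.strong_induction_on with
    | _ N ih =>
    intro X c D F hN hF hcX hcmin hoX hvX hD hDX
    set μ := prodBernoulli q with hμ
    have hmeas : ∀ S : Set (Set (Fin n)), MeasurableSet S := fun _ => MeasurableSet.of_discrete
    have hint : ∀ (g : Set (Fin n) → ℝ), Integrable g μ := fun g => Integrable.of_finite
    have hoc : o ≠ c := fun h => hoX (h ▸ hcX)
    have hvc : v ≠ c := fun h => hvX (h ▸ hcX)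
    -- the site pre-FKG surplus as a function of the relay set
    set PS : Finset (Fin n) → (Fin n → ℝ) := fun Y u =>
      ∫ ω in ⋃ a ∈ Y, siteConn Γ u a, (F (siteCluster Γ ω u) - F (siteCluster Γ ω c)) ∂μ with hPS
    rcases (X.erase c).eq_empty_or_nonempty with h0 | hne
    · -- base: `X = {c}`, `Δ ≡ 0`
      have hXc : X = {c} := by
        rw [← Finset.insert_erase hcX, h0]; rfl
      have hzero : PS X = fun _ => 0 := by
        funext u
        simp only [hPS, hXc]
        have hU : (⋃ a ∈ ({c} : Finset (Fin n)), (siteConn Γ u a : Set (Set (Fin n)))) = siteConn Γ u c := by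
          ext ω; simp
        rw [hU]
        rw [setIntegral_congr_fun (hmeas _) (g := fun _ => (0 : ℝ)) (fun ω hω => by
          show F (siteCluster Γ ω u) - F (siteCluster Γ ω c) = 0
          rw [siteCluster_eq_of_mem Γ ((mem_siteConn_iff_mem_siteCluster Γ u c ω).1 hω), sub_self])]
        simp
      show 0 ≤ cshMarg _ _ o v (PS X)
      rw [hzero]
      simp only [cshMarg]
      rw [show (fun _ : Fin n => (0 : ℝ)) = (0 : Fin n → ℝ) from rfl, slForm_zero]
      simp
    -- step: peel some `k ∈ X`, `k ≠ c`
    obtain ⟨k, hk⟩ := hne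
    have hkc : k ≠ c := (Finset.mem_erase.1 hk).1
    have hkX : k ∈ X := (Finset.mem_erase.1 hk).2
    set X' : Finset (Fin n) := X.erase k with hX'
    have hXcard : X'.card < N := by
      rw [hX', Finset.card_erase_of_mem hkX]; have := Finset.card_pos.2 ⟨k, hkX⟩; omega
    have hX'X : ∀ a ∈ X', a ∈ X := fun a ha => Finset.mem_of_mem_erase ha
    have hkX' : k ∉ X' := Finset.notMem_erase k X
    have hcX' : c ∈ X' := Finset.mem_erase.2 ⟨hkc.symm, hcX⟩
    have hko : o ≠ k := fun h => hoX (h ▸ hkX)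
    have hkv : v ≠ k := fun h => hvX (h ▸ hkX)
    have hkD : k ∉ D := fun h => (hDX k h).1 hkX
    have hmk : ∫ ω, F (siteCluster Γ ω c) ∂μ ≤ ∫ ω, F (siteCluster Γ ω k) ∂μ := hcmin k hkX
    -- the objects
    set Dk : Set (Set (Fin n)) := {ω : Set (Fin n) | ∀ a ∈ (↑X' : Set (Fin n)), a ∉ siteCluster Γ ω k} with hDk
    set gk : Set (Fin n) → ℝ := fun ω => F (siteCluster Γ ω k) - F (siteCluster Γ ω c) with hgk
    set L := decoyList Γ q (↑X : Set (Fin n)) D with hL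
    set p : ℝ := obsConst Γ q o v ((↑X : Set (Fin n)) ∪ {d | d ∈ D}) with hp
    set ck : Fin n → ℝ := avoidConst Γ q k (↑X' : Set (Fin n)) with hck
    -- the projected monotone functional of the peeled relay (benchmark `c`), site form
    set Gk : Set (Fin n) → ℝ := fun K => F K - ∫ η, F (siteCluster Γ (η \ bar Γ k K) c) ∂μ with hGk
    have hGk_mono : Monotone Gk := monotone_projFun q c k F hF
    set Tk : Fin n → ℝ := fun u => ∫ ω in Dk ∩ siteConn Γ k u, gk ω ∂μ with hTk
    set J : ℝ := ∫ ω in Dk, gk ω ∂μ with hJ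
    -- positivity of the conditioning events (non-degenerate weights): the all-closed configuration
    have hempty_Dk : (∅ : Set (Fin n)) ∈ Dk := by
      intro a _ h
      exact h.1
    have hDkpos : 0 < μ.real Dk := prodBernoulli_real_pos_of_nonempty hq ⟨∅, hempty_Dk⟩
    have hisopos : 0 < μ.real (Dk ∩ {ω | siteCluster Γ ω k = ∅}) :=
      prodBernoulli_real_pos_of_nonempty hq ⟨∅, hempty_Dk, Set.eq_empty_of_forall_notMem fun y hy => hy.1⟩
    -- set identities between the systems `(X; D)`, `(X'; k; D)` and `(X'; k :: D)`
    have hins : insert k (↑X' : Set (Fin n)) = ↑X := by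
      rw [hX', Finset.coe_erase, insert_sdiff_singleton, insert_eq_of_mem (Finset.mem_coe.2 hkX)]
    have hset2 : (↑X' : Set (Fin n)) ∪ {d | d ∈ k :: D} = (↑X : Set (Fin n)) ∪ {d | d ∈ D} := by
      ext a
      simp only [mem_union, Finset.mem_coe, hX', Finset.mem_erase, mem_setOf_eq, List.mem_cons]
      constructor
      · rintro (⟨_, ha⟩ | rfl | ha)
        · exact Or.inl ha
        · exact Or.inl hkX
        · exact Or.inr ha
      · rintro (ha | ha)
        · by_cases hak : a = k
          · exact Or.inr (Or.inl hak)
          · exact Or.inl ⟨hak, ha⟩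
        · exact Or.inr (Or.inr ha)
    have hcshMargin : ∀ f : Set (Fin n) → ℝ,
        cshMargin Γ q k (↑X' : Set (Fin n)) D o v f = cshMarg L p o v (covD Γ q k (↑X' : Set (Fin n)) f) := by
      intro f
      rw [cshMargin, hins]
    have hnext : cshMarg (decoyList Γ q (↑X' : Set (Fin n)) (k :: D)) (obsConst Γ q o v ((↑X' : Set (Fin n)) ∪ {d | d ∈ k :: D})) o v
        (PS X') = cshMarg L p o v (PS X') - PS X' k * cshMarg L p o v ck := by
      rw [hset2, decoyList, hins, cshMarg_cons]
    -- (1) peel `k`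
    have hpeel : PS X = PS X' + Tk := by
      funext u
      rw [Pi.add_apply]
      exact preSurplus_erase_add q X F c k u hkX
    -- (2) tower: the peeled term and its total through the projected functional `Gk`
    have hDk_S : ∀ u : Fin n, Dk ∩ siteConn Γ k u =
        {ω : Set (Fin n) | c ∉ siteCluster Γ ω k} ∩
          {ω | siteCluster Γ ω k ∈ {K : Set (Fin n) | (∀ a ∈ X', a ≠ c → a ∉ K) ∧ u ∈ K}} := by
      intro u; ext ω
      simp only [mem_inter_iff, hDk, mem_setOf_eq, Finset.mem_coe]
      constructor
      · rintro ⟨h1, h2⟩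
        exact ⟨h1 c hcX', fun a ha _ => h1 a ha, (mem_siteConn_iff_mem_siteCluster Γ k u ω).1 h2⟩
      · rintro ⟨h1, h2, h3⟩
        refine ⟨fun a ha => ?_, (mem_siteConn_iff_mem_siteCluster Γ k u ω).2 h3⟩
        by_cases hac : a = c
        · rw [hac]; exact h1
        · exact h2 a ha hac
    have hDk_0 : Dk = {ω : Set (Fin n) | c ∉ siteCluster Γ ω k} ∩
          {ω | siteCluster Γ ω k ∈ {K : Set (Fin n) | ∀ a ∈ X', a ≠ c → a ∉ K}} := by
      ext ω
      simp only [mem_inter_iff, hDk, mem_setOf_eq, Finset.mem_coe]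
      constructor
      · intro h1
        exact ⟨h1 c hcX', fun a ha _ => h1 a ha⟩
      · rintro ⟨h1, h2⟩ a ha
        by_cases hac : a = c
        · rw [hac]; exact h1
        · exact h2 a ha hac
    have towU : ∀ u : Fin n, Tk u = ∫ ω in Dk ∩ siteConn Γ k u, Gk (siteCluster Γ ω k) ∂μ := by
      intro u
      simp only [hTk, hgk]
      rw [hDk_S u]
      exact setIntegral_sub_eq_projFun q c k F _
    have tow0 : J = ∫ ω in Dk, Gk (siteCluster Γ ω k) ∂μ := by
      simp only [hJ, hgk]
      rw [hDk_0]
      exact setIntegral_sub_eq_projFun q c k F _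
    -- the total `J = (m_k − m_c) − Δ_k(X')`
    have hJtot : J = ((∫ ω, F (siteCluster Γ ω k) ∂μ) - ∫ ω, F (siteCluster Γ ω c) ∂μ) - PS X' k := by
      have h1 := integral_add_compl (hmeas Dk) (hint gk)
      have hDkc : Dkᶜ = ⋃ a' ∈ X', (siteConn Γ k a' : Set (Set (Fin n))) := by
        ext ω
        rw [mem_iUnion_siteConn, mem_compl_iff, hDk]
        simp only [mem_setOf_eq, Finset.mem_coe, not_forall, not_not, exists_prop]
      have h2 : ∫ ω in Dkᶜ, gk ω ∂μ = PS X' k := by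
        rw [hDkc]
      have h3 : ∫ ω, gk ω ∂μ = (∫ ω, F (siteCluster Γ ω k) ∂μ) - ∫ ω, F (siteCluster Γ ω c) ∂μ := by
        rw [hgk, integral_sub (hint _) (hint _)]
      rw [hJ]; linarith
    -- (2') the peeled term through `covD`
    have hTk_cov : (μ.real Dk) • Tk = covD Γ q k (↑X' : Set (Fin n)) Gk + J • ((μ.real Dk) • ck) := by
      funext u
      simp only [Pi.add_apply, Pi.smul_apply, smul_eq_mul]
      have h2 : μ.real (Dk ∩ siteConn Γ k u) = μ.real Dk * ck u := by
        simp only [hck, avoidConst, hDk]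
        rw [mul_div_cancel₀ _ (ne_of_gt hDkpos)]
      rw [towU u]
      unfold covD
      rw [← hDk, ← tow0, h2]
      ring
    -- (3) site CSH for the peeled relay, functional `Gk`
    have hCSHk := hCSH k X' D hkX' hko hkv (fun h => hoX (hX'X o h)) (fun h => hvX (hX'X v h)) hD
      (fun d hd => ⟨fun h => hkD (h ▸ hd), fun h => (hDX d hd).1 (hX'X d h), (hDX d hd).2.1, (hDX d hd).2.2⟩)
    have h3 : 0 ≤ cshMarg L p o v (covD Γ q k (↑X' : Set (Fin n)) Gk) := by
      rw [← hcshMargin]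
      exact hCSHk Gk hGk_mono
    -- (4) Lemma AC: `Marg[c_k] ≥ 0` from site CSH applied to `Ψ_iso`
    have h4 : 0 ≤ cshMarg L p o v ck := by
      have hiso := hCSHk psiIsoSite psiIso_mono
      rw [hcshMargin] at hiso
      have hLk : ∀ dc ∈ L, dc.1 ≠ k := fun dc hdc h => hkD (h ▸ mem_decoyList q _ D dc hdc)
      rw [cshMarg_congr L p o v (covD Γ q k (↑X' : Set (Fin n)) psiIsoSite)
        ((μ.real (Dk ∩ {ω | siteCluster Γ ω k = ∅}) * μ.real Dk) • ck) (fun u => u ≠ k) hLk hko hkv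
        (fun u _ => by
          rw [covD_psiIso q X' k u, Pi.smul_apply, smul_eq_mul]
          simp only [hck, avoidConst, hDk]
          rw [mul_assoc, mul_div_cancel₀ _ (ne_of_gt hDkpos)]), cshMarg_smul] at hiso
      exact (mul_nonneg_iff_of_pos_left (mul_pos hisopos hDkpos)).1 hiso
    -- (5) the replacement of Lemma κ: `J ≥ −Δ_k(X')` (only use of `m_c ≤ m_k`)
    have h5 : -PS X' k ≤ J := by rw [hJtot]; linarith [hmk]
    -- (6) the next rung by induction
    have h6 : 0 ≤ cshMarg (decoyList Γ q (↑X' : Set (Fin n)) (k :: D)) (obsConst Γ q o v ((↑X' : Set (Fin n)) ∪ {d | d ∈ k :: D}))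
        o v (PS X') :=
      ih X'.card hXcard X' c (k :: D) F rfl hF hcX' (fun a ha => hcmin a (hX'X a ha)) (fun h => hoX (hX'X o h))
        (fun h => hvX (hX'X v h)) (List.nodup_cons.2 ⟨hkD, hD⟩)
        (fun d hd => by
          rcases List.mem_cons.1 hd with rfl | hd
          · exact ⟨hkX', hko.symm, hkv.symm⟩
          · exact ⟨fun h => (hDX d hd).1 (hX'X d h), (hDX d hd).2.1, (hDX d hd).2.2⟩)
    -- (7) assemble
    have hmain : μ.real Dk * cshMarg L p o v (PS X) =
        μ.real Dk * cshMarg L p o v (PS X') + cshMarg L p o v (covD Γ q k (↑X' : Set (Fin n)) Gk) +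
          J * μ.real Dk * cshMarg L p o v ck := by
      have e1 : μ.real Dk * cshMarg L p o v Tk =
          cshMarg L p o v (covD Γ q k (↑X' : Set (Fin n)) Gk) + J * μ.real Dk * cshMarg L p o v ck := by
        rw [← cshMarg_smul, hTk_cov, cshMarg_add, cshMarg_smul, cshMarg_smul]; ring
      rw [hpeel, cshMarg_add, mul_add, e1]
      ring
    have hbound : μ.real Dk * cshMarg (decoyList Γ q (↑X' : Set (Fin n)) (k :: D))
        (obsConst Γ q o v ((↑X' : Set (Fin n)) ∪ {d | d ∈ k :: D})) o v (PS X') ≤ μ.real Dk * cshMarg L p o v (PS X) := by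
      rw [hmain, hnext]
      have := mul_le_mul_of_nonneg_right h5 (mul_nonneg hDkpos.le h4)
      nlinarith [h3, h4, this, hDkpos.le]
    show 0 ≤ cshMarg L p o v (PS X)
    exact le_of_mul_le_mul_left (by linarith [mul_nonneg hDkpos.le h6]) hDkpos
  intro X c D F hF hcX hcmin hoX hvX hD hDX
  exact main X.card X c D F rfl hF hcX hcmin hoX hvX hD hDX

end SitePreFKG

end Summit.CriticalPhenomena.PercolationContinuityZ3.Theorems.Transplant
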